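import Summits.KontsevichZagierPeriods.KontsevichZagierPeriods.Theorems.RootDecompQuadraticDescentEisensteinPairP4

/-!
# Census pair #22 (the ℚ(√−3) pair 4·[□²,1/(3−2N)] ≡ 5·[□²,1/(3−N)], N = u²−uv+v²) and #0 DECIDED in `KZ.relations` by rules 1+2 (route `RootDecompQuadraticDescent`, instances of crux stmt-KontsevichZagierPeriods-28994 / stmt-4280) · part 5/7

Cell `decomp-kz`, lens 6 (decomp-kz-lens-6 g7): `pair22 : 4•[□²,1/(1+2x+2y−2x²+2xy−2y²)] − 5•[□²,1/(2+x+y−x²+xy−y²)] ∈ KZ.relations` (values (5/8)·L(2,χ₋₃), L(2,χ₋₃)/2): reflections → diagonal cut + fold → BLOW-UP (u,k) ↦ (u,uk) via `KZ.of_sub_of_mem_relations_of_affine` → fibre substitution into a LOG BAND over q(u) = 1−u+u² → 23 band relations incl. SEVEN ℚ-rational base substitutions (dihedral symmetries + angle doublings of the Eisenstein conic) + one ℤ-identity; NO Stokes; `pair0` by ONE Möbius substitution y = x/(2−x); packaged `pairs_decided`, `pairs_descentTwoQ_instances`, `pairs_of_kzDimTwo` BY NAME.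

Source: `HOME/decomp-kz-lens-6/g7/EisensteinPair22.lean` sha256 fdb5e0bbc5a4a341 (1894 l; critic decomp-kz-crit-1 g2 CLEARED 2026-08-30T07:59:44Z, std axioms), split into 7 modules by the landing seat decomp-kz-census-1 g7 (contexts re-opened per part; generic docstrings added where the source had none; the route file is imported only by the last part, which proves the `KZDimTwo` corollaries BY NAME).  No `sorry`; standard axioms.  References: [cite: KontsevichZagier2001, §1.2].
-/

noncomputable section

open MeasureTheory Set MvPolynomial

namespace Summit.KontsevichZagierPeriods.RootDecompQuadraticDescent.EisensteinPair

open Literature.NumberTheory.Transcendental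
open Literature.NumberTheory.Transcendental.KZ
open Literature.ModelTheory.ExponentialFields (IsSemialgebraic)

-- PRIVATE copy (landed twins in farm-unbuilt HermiteRigidity modules / my BlowupPair / DarkPairs; dedup.landed): isSemialgebraic_Δ₁
/-- `isSemialgebraic_Δ₁`: auxiliary theorem of the lens-6 development «eis» (instances of 28994/4280) — see the module docstring; verbatim from the lens file. -/
private theorem isSemialgebraic_Δ₁ : IsSemialgebraic ℚ Δ₁ := by
  have h := Literature.ModelTheory.ExponentialFields.isSemialgebraic_setOf_eval_le (k := ℚ) (R := ℝ)
    (X 1 : MvPolynomial (Fin 2) ℚ) (X 0)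
  simp only [aeval_X] at h
  exact isSemialgebraic_cube.inter h

-- PRIVATE copy (landed twin lives in a farm-unbuilt module; dedup.landed): snoc2_zero, snoc2_one, init2_zero, last_one_eq
/-- `snoc2_zero`: auxiliary theorem of the lens-6 development «eis» (instances of 28994/4280) — see the module docstring; verbatim from the lens file. -/
@[simp] private theorem snoc2_zero (x : Fin 1 → ℝ) (t : ℝ) : (Fin.snoc x t : Fin 2 → ℝ) 0 = x 0 := rfl

/-- `snoc2_one`: auxiliary theorem of the lens-6 development «eis» (instances of 28994/4280) — see the module docstring; verbatim from the lens file. -/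
@[simp] private theorem snoc2_one (x : Fin 1 → ℝ) (t : ℝ) : (Fin.snoc x t : Fin 2 → ℝ) 1 = t := rfl

/-- `init2_zero`: auxiliary theorem of the lens-6 development «eis» (instances of 28994/4280) — see the module docstring; verbatim from the lens file. -/
@[simp] private theorem init2_zero (z : Fin 2 → ℝ) : Fin.init z 0 = z 0 := rfl

/-- `last_one_eq`: auxiliary theorem of the lens-6 development «eis» (instances of 28994/4280) — see the module docstring; verbatim from the lens file. -/
private theorem last_one_eq : (Fin.last 1 : Fin 2) = 1 := rfl

section Geometry

/-- `isSemialgebraic_Δ₂`: auxiliary theorem of the lens-6 development «eis» (instances of 28994/4280) — see the module docstring; verbatim from the lens file. -/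
private theorem isSemialgebraic_Δ₂ : IsSemialgebraic ℚ Δ₂ := by
  have h := Literature.ModelTheory.ExponentialFields.isSemialgebraic_setOf_eval_le (k := ℚ) (R := ℝ)
    (X 0 : MvPolynomial (Fin 2) ℚ) (X 1)
  simp only [aeval_X] at h
  exact isSemialgebraic_cube.inter h

/-- `[Δ₁, T]`. -/
def rLow (T : RFun 2) : IntegralRep 2 := T.rep.restrict Δ₁ isSemialgebraic_Δ₁ fun _ hz => hz.1
/-- `[Δ₂, T]`. -/
def rUp (T : RFun 2) : IntegralRep 2 := T.rep.restrict Δ₂ isSemialgebraic_Δ₂ fun _ hz => hz.1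

/-- `rLow_domain`: auxiliary theorem of the lens-6 development «eis» (instances of 28994/4280) — see the module docstring; verbatim from the lens file. -/
@[simp] private theorem rLow_domain (T : RFun 2) : (rLow T).domain = Δ₁ := rfl
/-- `rUp_domain`: auxiliary theorem of the lens-6 development «eis» (instances of 28994/4280) — see the module docstring; verbatim from the lens file. -/
@[simp] private theorem rUp_domain (T : RFun 2) : (rUp T).domain = Δ₂ := rfl
/-- `rLow_integrand`: auxiliary theorem of the lens-6 development «eis» (instances of 28994/4280) — see the module docstring; verbatim from the lens file. -/
@[simp] private theorem rLow_integrand (T : RFun 2) : (rLow T).integrand = T.fn := rfl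
/-- `rUp_integrand`: auxiliary theorem of the lens-6 development «eis» (instances of 28994/4280) — see the module docstring; verbatim from the lens file. -/
@[simp] private theorem rUp_integrand (T : RFun 2) : (rUp T).integrand = T.fn := rfl

/-- Rule 1a along the diagonal: `[□², T] ≡ [Δ₁, T] + [Δ₂, T]`. -/
theorem rel_diag (T : RFun 2) : KZ.of T.rep - KZ.of (rLow T) - KZ.of (rUp T) ∈ KZ.relations := by
  refine domainAddRel_subset_relations ⟨2, T.rep, rLow T, rUp T, ?_, ?_, fun z _ => rfl, fun z _ => rfl, rfl⟩
  · ext z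
    simp only [RFun.rep_domain, rLow_domain, rUp_domain, Δ₁, Δ₂, mem_union, mem_setOf_eq]
    constructor
    · intro hz
      rcases le_total (z 1) (z 0) with h | h
      · exact Or.inl ⟨hz, h⟩
      · exact Or.inr ⟨hz, h⟩
    · rintro (⟨hz, _⟩ | ⟨hz, _⟩) <;> exact hz
  · refine measure_mono_null (fun z hz => ?_)
      (volume_graph_eq_zero (n := 1) (σ := univ) (u := fun y => y 0)
        ((isSemialgebraicFunOn_aeval Literature.ModelTheory.ExponentialFields.isSemialgebraic_univ
          (X 0 : MvPolynomial (Fin 1) ℚ)).congr fun y _ => by simp))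
    simp only [rLow_domain, rUp_domain, Δ₁, Δ₂, mem_inter_iff, mem_setOf_eq] at hz
    refine ⟨mem_univ _, ?_⟩
    rw [last_one_eq]
    show z 1 = z (Fin.castSucc 0)
    exact le_antisymm hz.1.2 (by simpa using hz.2.2)

/-- Rule 2 with the coordinate swap: `[Δ₂, T] ≡ [Δ₁, T]` for a symmetric `T`. -/
theorem rel_swapΔ (T : RFun 2) (hT : ∀ z : Fin 2 → ℝ, T.fn z = T.fn (z ∘ Equiv.swap 0 1)) :
    KZ.of (rUp T) - KZ.of (rLow T) ∈ KZ.relations := by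
  refine permRel_subset_relations ⟨2, rUp T, rLow T, Equiv.swap 0 1, ?_, fun z _ => hT z, rfl⟩
  ext z
  simp only [rLow_domain, rUp_domain, Δ₁, Δ₂, mem_image, mem_setOf_eq, mem_cube]
  constructor
  · rintro ⟨hz, h⟩
    refine ⟨z ∘ Equiv.swap 0 1, ⟨fun i => hz _, by simpa using h⟩, ?_⟩
    funext i
    simp
  · rintro ⟨w, ⟨hw, h⟩, rfl⟩
    exact ⟨fun i => hw _, by simpa using h⟩

/-- `[□², T] ≡ 2·[Δ₁, T]` for a symmetric `T`. -/
theorem rel_fold_diag (T : RFun 2) (hT : ∀ z : Fin 2 → ℝ, T.fn z = T.fn (z ∘ Equiv.swap 0 1)) :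
    KZ.of T.rep - 2 • KZ.of (rLow T) ∈ KZ.relations := by
  have h1 := rel_diag T
  have h2 := rel_swapΔ T hT
  have : KZ.of T.rep - 2 • KZ.of (rLow T) =
      (KZ.of T.rep - KZ.of (rLow T) - KZ.of (rUp T)) + (KZ.of (rUp T) - KZ.of (rLow T)) := by abel
  rw [this]
  exact KZ.relations.add_mem h1 h2

end Geometry

section BlowUp

/-! ### The open triangle, the blow-up of its corner, and the fibre substitution into the band -/

/-- `w = snoc (init w) 0 + w_last • (0,…,0,1)`: the splitting of `ℝᵐ⁺¹ = ℝᵐ × ℝ` used in the Jacobian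
computation of `KZ.of_sub_of_mem_relations_of_fibreMap`. (Source: cell `decomp-kz`, lens 2 gen 4,
`RationalCubeDichotomy.lean` v5, sha256 `eccce7f4…`, l. 1699.) [folklore] -/
private theorem eq_snoc_init_zero_add' (m : ℕ) (w : Fin (m + 1) → ℝ) :
    w = Fin.snoc (Fin.init w) (0 : ℝ) + w (Fin.last m) • (Pi.single (Fin.last m) (1 : ℝ) : Fin (m + 1) → ℝ) := by
  ext i
  refine Fin.lastCases ?_ (fun j => ?_) i
  · simp
  · simp [(Fin.castSucc_lt_last j).ne, Fin.init]

/-- **Fibred substitution with a Jacobian allowed to vanish on the lower edge.** Verbatim copy of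
`KZ.of_sub_of_mem_relations_of_fibreMap` (Literature/NumberTheory/Transcendental/KZFibreMapMove.lean)
with the hypothesis `0 < ψs` weakened to the OPEN fibres `a y < s < b y` plus `0 ≤ ψs` on the closed
band — exactly what strict monotonicity (`strictMonoOn_of_deriv_pos` on the interior) and the
integrand identity (`|det| = ψs`) use. Needed here because the substitution `s ↦ 3/(3 − μs²q(u))`
has `∂/∂s = 0` on the edge `s = 0` (the exceptional divisor of the blow-up).
[cite: KontsevichZagier2001, §1.2 rule 2] -/
private theorem of_sub_of_mem_relations_of_fibreMap' {m : ℕ} {G : Set (Fin m → ℝ)}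
    {a b a' b' : (Fin m → ℝ) → ℝ} (ψ ψs : (Fin (m + 1) → ℝ) → ℝ)
    (r r' : IntegralRep (m + 1)) (hr : r.domain = KZlog.band G a b)
    (hr' : r'.domain = KZlog.band G a' b') (hab : ∀ y ∈ G, a y ≤ b y)
    (hψ : IsSemialgebraicFunOn ℚ r.domain ψ)
    (hψd : ∀ z ∈ r.domain, DifferentiableAt ℝ ψ z)
    (hψs : ∀ z ∈ r.domain,
      HasDerivAt (fun t : ℝ => ψ (Fin.snoc (Fin.init z) t)) (ψs z) (z (Fin.last m)))
    (hpos : ∀ z ∈ r.domain, a (Fin.init z) < z (Fin.last m) → z (Fin.last m) < b (Fin.init z) → 0 < ψs z)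
    (hnn : ∀ z ∈ r.domain, 0 ≤ ψs z)
    (ha : ∀ y ∈ G, ψ (Fin.snoc y (a y)) = a' y) (hb : ∀ y ∈ G, ψ (Fin.snoc y (b y)) = b' y)
    (hint : ∀ z ∈ r.domain, r.integrand z = r'.integrand (Fin.snoc (Fin.init z) (ψ z)) * ψs z) :
    of r - of r' ∈ relations := by
  have hmemG : ∀ z ∈ r.domain, Fin.init z ∈ G := fun z hz => by
    rw [hr] at hz
    exact hz.1
  have hsnoc_mem : ∀ y ∈ G, ∀ t ∈ Icc (a y) (b y), (Fin.snoc y t : Fin (m + 1) → ℝ) ∈ r.domain := by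
    intro y hy t ht
    rw [hr, KZlog.snoc_mem_band]
    exact ⟨hy, ht⟩
  -- the fibre maps
  have hfib_deriv : ∀ y ∈ G, ∀ t ∈ Icc (a y) (b y),
      HasDerivAt (fun s : ℝ => ψ (Fin.snoc y s)) (ψs (Fin.snoc y t)) t := by
    intro y hy t ht
    have h := hψs _ (hsnoc_mem y hy t ht)
    simpa only [Fin.init_snoc, Fin.snoc_last] using h
  have hfib_cont : ∀ y ∈ G, ContinuousOn (fun s : ℝ => ψ (Fin.snoc y s)) (Icc (a y) (b y)) :=
    fun y hy t ht => (hfib_deriv y hy t ht).continuousAt.continuousWithinAt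
  have hfib_mono : ∀ y ∈ G, StrictMonoOn (fun s : ℝ => ψ (Fin.snoc y s)) (Icc (a y) (b y)) := by
    intro y hy
    refine strictMonoOn_of_deriv_pos (convex_Icc _ _) (hfib_cont y hy) fun t ht => ?_
    rw [interior_Icc] at ht
    have hd := hfib_deriv y hy t (Ioo_subset_Icc_self ht)
    rw [hd.deriv]
    exact hpos _ (hsnoc_mem y hy t (Ioo_subset_Icc_self ht)) (by simpa using ht.1) (by simpa using ht.2)
  -- the substitution
  set Φ : (Fin (m + 1) → ℝ) → (Fin (m + 1) → ℝ) := fun z => Fin.snoc (Fin.init z) (ψ z) with hΦ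
  let Φ' : (Fin (m + 1) → ℝ) → (Fin (m + 1) → ℝ) →L[ℝ] (Fin (m + 1) → ℝ) := fun z =>
    ContinuousLinearMap.pi
      (Fin.lastCases (motive := fun _ => (Fin (m + 1) → ℝ) →L[ℝ] ℝ) (fderiv ℝ ψ z)
        (fun i => ContinuousLinearMap.proj (Fin.castSucc i)))
  have hΦ' : ∀ z w, Φ' z w = Fin.snoc (Fin.init w) (fderiv ℝ ψ z w) := by
    intro z w
    funext i
    refine Fin.lastCases ?_ (fun j => ?_) i
    · simp [Φ']
    · simp [Φ', Fin.init]
  -- the partial derivative along the last coordinate is `ψs`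
  have hlast : ∀ z ∈ r.domain, fderiv ℝ ψ z (Pi.single (Fin.last m) 1) = ψs z := by
    intro z hz
    have hγ : HasDerivAt (fun t : ℝ => (Fin.snoc (Fin.init z) t : Fin (m + 1) → ℝ))
        (Pi.single (Fin.last m) (1 : ℝ)) (z (Fin.last m)) := by
      rw [hasDerivAt_pi]
      intro i
      refine Fin.lastCases ?_ (fun j => ?_) i
      · simpa using hasDerivAt_id' (z (Fin.last m))
      · simpa [(Fin.castSucc_lt_last j).ne, Fin.init] using hasDerivAt_const (z (Fin.last m)) (z (Fin.castSucc j))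
    have h1 : HasDerivAt (fun t : ℝ => ψ (Fin.snoc (Fin.init z) t))
        (fderiv ℝ ψ z (Pi.single (Fin.last m) 1)) (z (Fin.last m)) := by
      have hψz : HasFDerivAt ψ (fderiv ℝ ψ z) (Fin.snoc (Fin.init z) (z (Fin.last m))) := by
        rw [Fin.snoc_init_self]
        exact (hψd z hz).hasFDerivAt
      exact hψz.comp_hasDerivAt (z (Fin.last m)) hγ
    exact h1.unique (hψs z hz)
  -- determinant
  have hdet : ∀ z ∈ r.domain, (Φ' z).det = ψs z := by
    intro z hz
    let E : (Fin m → ℝ) →ₗ[ℝ] (Fin (m + 1) → ℝ) :=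
      LinearMap.pi (Fin.lastCases (motive := fun _ => (Fin m → ℝ) →ₗ[ℝ] ℝ) 0
        (fun i => LinearMap.proj i))
    have hE : ∀ y, E y = Fin.snoc y 0 := by
      intro y
      funext i
      refine Fin.lastCases ?_ (fun j => ?_) i
      · simp [E]
      · simp [E]
    have h := LinearMap.det_of_snoc_init (Φ' z : (Fin (m + 1) → ℝ) →ₗ[ℝ] (Fin (m + 1) → ℝ))
      LinearMap.id ((fderiv ℝ ψ z : (Fin (m + 1) → ℝ) →ₗ[ℝ] ℝ).comp E)
      (fderiv ℝ ψ z (Pi.single (Fin.last m) 1)) (fun w => by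
        rw [ContinuousLinearMap.coe_coe, hΦ', LinearMap.id_apply, LinearMap.comp_apply,
          ContinuousLinearMap.coe_coe, hE]
        congr 1
        conv_lhs => rw [eq_snoc_init_zero_add' m w]
        rw [map_add, map_smul, smul_eq_mul, mul_comm])
    rw [LinearMap.det_id, mul_one, hlast z hz] at h
    exact h
  -- derivative
  have hderiv : ∀ z ∈ r.domain, HasFDerivAt Φ (Φ' z) z := by
    intro z hz
    rw [hasFDerivAt_pi']
    intro i
    refine Fin.lastCases ?_ (fun j => ?_) i
    · have hfun : (fun x => Φ x (Fin.last m)) = ψ := by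
        funext x
        simp [hΦ]
      show HasFDerivAt (fun x => Φ x (Fin.last m)) _ z
      rw [hfun]
      refine (hψd z hz).hasFDerivAt.congr_fderiv (ContinuousLinearMap.ext fun w => ?_)
      simp [hΦ']
    · have hfun : (fun x => Φ x (Fin.castSucc j)) = fun x => x (Fin.castSucc j) := by
        funext x
        simp [hΦ, Fin.init]
      show HasFDerivAt (fun x => Φ x (Fin.castSucc j)) _ z
      rw [hfun]
      refine (hasFDerivAt_apply (Fin.castSucc j) z).congr_fderiv
        (ContinuousLinearMap.ext fun w => ?_)
      simp [hΦ', Fin.init]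
  refine changeOfVariablesRel_subset_relations ⟨m + 1, r, r', Φ, Φ', ?_, ?_, ?_, ?_, ?_, rfl⟩
  · -- semialgebraic map
    refine (isSemialgebraicMapOn_iff_forall_holds r.isSemialgebraic_domain).mpr fun i => ?_
    refine Fin.lastCases ?_ (fun j => ?_) i
    · exact hψ.congr fun z _ => by simp [hΦ]
    · exact (isSemialgebraicFunOn_aeval r.isSemialgebraic_domain
        (MvPolynomial.X (Fin.castSucc j))).congr fun z _ => by simp [hΦ, Fin.init]
  · exact fun z hz => (hderiv z hz).hasFDerivWithinAt
  · -- injective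
    intro z₁ hz₁ z₂ hz₂ h
    have hy : Fin.init z₁ = Fin.init z₂ := by
      have := congrArg Fin.init h
      simpa [hΦ] using this
    have hl : ψ z₁ = ψ z₂ := by
      have := congrFun h (Fin.last m)
      simpa [hΦ] using this
    have hyG : Fin.init z₂ ∈ G := hmemG z₂ hz₂
    have ht₁ : z₁ (Fin.last m) ∈ Icc (a (Fin.init z₂)) (b (Fin.init z₂)) := by
      rw [hr] at hz₁; rw [← hy]; exact hz₁.2
    have ht₂ : z₂ (Fin.last m) ∈ Icc (a (Fin.init z₂)) (b (Fin.init z₂)) := by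
      rw [hr] at hz₂; exact hz₂.2
    have hl' : ψ (Fin.snoc (Fin.init z₂) (z₁ (Fin.last m))) = ψ (Fin.snoc (Fin.init z₂) (z₂ (Fin.last m))) := by
      rw [Fin.snoc_init_self]
      conv_lhs => rw [← hy, Fin.snoc_init_self]
      exact hl
    have hs : z₁ (Fin.last m) = z₂ (Fin.last m) := (hfib_mono _ hyG).injOn ht₁ ht₂ hl'
    rw [← Fin.snoc_init_self z₁, ← Fin.snoc_init_self z₂, hy, hs]
  · -- image
    rw [hr']
    ext w
    simp only [mem_image]
    constructor
    · intro hw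
      rw [KZlog.mem_band] at hw
      obtain ⟨hy, hw1, hw2⟩ := hw
      have hab' := hab _ hy
      have hivt := intermediate_value_Icc hab' (hfib_cont _ hy)
      rw [ha _ hy, hb _ hy] at hivt
      obtain ⟨t, ht, hwt⟩ := hivt ⟨hw1, hw2⟩
      have hwt' : ψ (Fin.snoc (Fin.init w) t) = w (Fin.last m) := hwt
      refine ⟨Fin.snoc (Fin.init w) t, hsnoc_mem _ hy t ht, ?_⟩
      simp only [hΦ, Fin.init_snoc]
      rw [hwt', Fin.snoc_init_self]
    · rintro ⟨z, hz, rfl⟩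
      have hy : Fin.init z ∈ G := hmemG z hz
      have ht : z (Fin.last m) ∈ Icc (a (Fin.init z)) (b (Fin.init z)) := by
        rw [hr] at hz; exact hz.2
      have hmono := (hfib_mono _ hy).monotoneOn
      have haz : a (Fin.init z) ∈ Icc (a (Fin.init z)) (b (Fin.init z)) := left_mem_Icc.mpr (hab _ hy)
      have hbz : b (Fin.init z) ∈ Icc (a (Fin.init z)) (b (Fin.init z)) := right_mem_Icc.mpr (hab _ hy)
      have h1 := hmono haz ht ht.1
      have h2 := hmono ht hbz ht.2
      simp only [ha _ hy, hb _ hy, Fin.snoc_init_self] at h1 h2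
      rw [KZlog.mem_band]
      simp only [hΦ, Fin.init_snoc, Fin.snoc_last]
      exact ⟨hy, h1, h2⟩
  · intro z hz
    rw [hint z hz, hdet z hz, abs_of_nonneg (hnn z hz)]

/-- The open base interval `{0 < u < 1}`. -/
def Gopen : Set (Fin 1 → ℝ) := {y | 0 < y 0 ∧ y 0 < 1}

/-- `isOpen_Gopen`: auxiliary theorem of the lens-6 development «eis» (instances of 28994/4280) — see the module docstring; verbatim from the lens file. -/
theorem isOpen_Gopen : IsOpen Gopen :=
  (isOpen_lt continuous_const (continuous_apply 0)).inter (isOpen_lt (continuous_apply 0) continuous_const)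

/-- `isSemialgebraic_Gopen`: auxiliary theorem of the lens-6 development «eis» (instances of 28994/4280) — see the module docstring; verbatim from the lens file. -/
theorem isSemialgebraic_Gopen : IsSemialgebraic ℚ Gopen := by
  have h1 := Literature.ModelTheory.ExponentialFields.isSemialgebraic_setOf_eval_lt (k := ℚ) (R := ℝ)
    (C 0 : MvPolynomial (Fin 1) ℚ) (X 0)
  have h2 := Literature.ModelTheory.ExponentialFields.isSemialgebraic_setOf_eval_lt (k := ℚ) (R := ℝ)
    (X 0 : MvPolynomial (Fin 1) ℚ) (C 1)
  simp only [aeval_X, aeval_C, eq_ratCast, Rat.cast_zero, Rat.cast_one] at h1 h2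
  exact h1.inter h2

/-- `isSemialgebraicFunOn_coord0`: auxiliary theorem of the lens-6 development «eis» (instances of 28994/4280) — see the module docstring; verbatim from the lens file. -/
private theorem isSemialgebraicFunOn_coord0 {G : Set (Fin 1 → ℝ)} (hG : IsSemialgebraic ℚ G) :
    IsSemialgebraicFunOn ℚ G fun y : Fin 1 → ℝ => y 0 :=
  (isSemialgebraicFunOn_aeval hG (X 0)).congr fun y _ => by simp

/-- `isSemialgebraicFunOn_zero'`: auxiliary theorem of the lens-6 development «eis» (instances of 28994/4280) — see the module docstring; verbatim from the lens file. -/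
private theorem isSemialgebraicFunOn_zero' {G : Set (Fin 1 → ℝ)} (hG : IsSemialgebraic ℚ G) :
    IsSemialgebraicFunOn ℚ G fun _ : Fin 1 → ℝ => (0 : ℝ) := by
  simpa using isSemialgebraicFunOn_ratCast hG 0

/-- `isSemialgebraicFunOn_one'`: auxiliary theorem of the lens-6 development «eis» (instances of 28994/4280) — see the module docstring; verbatim from the lens file. -/
private theorem isSemialgebraicFunOn_one' {G : Set (Fin 1 → ℝ)} (hG : IsSemialgebraic ℚ G) :
    IsSemialgebraicFunOn ℚ G fun _ : Fin 1 → ℝ => (1 : ℝ) := by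
  simpa using isSemialgebraicFunOn_ratCast hG 1

/-- The triangle minus its vertical edges, as a band: `Δ° = {0 < u < 1, 0 ≤ y ≤ u}`. -/
def Δo : Set (Fin 2 → ℝ) := KZlog.band Gopen (fun _ => 0) fun y => y 0
/-- The square minus two edges, as a band: `S° = {0 < u < 1, 0 ≤ k ≤ 1}`. -/
def So : Set (Fin 2 → ℝ) := KZlog.band Gopen (fun _ => 0) fun _ => 1

/-- `isSemialgebraic_Δo`: auxiliary theorem of the lens-6 development «eis» (instances of 28994/4280) — see the module docstring; verbatim from the lens file. -/
private theorem isSemialgebraic_Δo : IsSemialgebraic ℚ Δo :=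
  KZlog.isSemialgebraic_band (isSemialgebraicFunOn_zero' isSemialgebraic_Gopen)
    (isSemialgebraicFunOn_coord0 isSemialgebraic_Gopen)

end BlowUp

end Summit.KontsevichZagierPeriods.RootDecompQuadraticDescent.EisensteinPair

end
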